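import Summits.BirchSwinnertonDyer.Uniform.U2.RingClassRestriction
import HarnessLib

/-!
# Cell «bsd-uniform», track U2, route C — restriction API, part 2: lifting, fibres, and the
# TRANSPORT OF A RELATIVE TRACE from `E(K[m'])` to `E(K[n])` (`m ∣ m' ∣ n`)

HONEST FRAMING (cell «bsd-uniform», run/shared/lean/pub/bsd-uniform/, seat u2-p3): field-theoretic
plumbing over the tree's ring class fields; nothing arithmetic is asserted. With part 1
(`RingClassRestriction.lean`: `restrictGal`, `coe_restrictGal_apply`,
`map_inclusion_pointGalHom_restrictGal`) this file proves that a trace identity over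
`Gal(K[m']/K[m])` printed at top field `K[m']` (the currency of the landed one-step facts
`CoatesLiTianZhai2015.traceRelation_inert`, `Darmon2004.prop310_normCompatibility`,
`GrossLMS1991.prop37_1_traceRelation`) becomes, after pushing the points to `E(K[n])`, the RELATIVE
trace over `Gal(K[n]/K[m]) / Gal(K[n]/K[m'])` that `GenusCongruence.sum_quotient_eq_smul_of_rel`
folds — so a tower `K ⊂ K[1] ⊂ K[q₁] ⊂ … ⊂ K[M]` of printed one-step relations yields the composed
`htr` of `GenusPointRingClass.genusPoint_not_isOfFinAddOrder_of_trace`.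

## Contents
* `restrictGal_mem_ringClassGalOver`: `σ ∈ Gal(K[n]/K[m]) ⇒ res σ ∈ Gal(K[m']/K[m])`.
* `exists_restrictGal_eq`: every `τ ∈ Gal(K[m']/K[m])` is `res σ` for some `σ ∈ Gal(K[n]/K[m])`
  (Mathlib `AlgEquiv.liftNormal`, `K[n]/K` normal).
* `restrictGal_eq_iff`: `res σ₁ = res σ₂ ⟺ σ₁⁻¹σ₂ ∈ Gal(K[n]/K[m'])`.
* `sum_quotient_pointGalHom_map_inclusion`: the relative-trace transport.
-/

noncomputable section

open scoped Classical

open WeierstrassCurve NumberField Literature.NumberTheory.EllipticCurves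
  Literature.NumberTheory.EllipticCurves.ModularForms

set_option autoImplicit false

namespace Summit.BirchSwinnertonDyer.Uniform.U2.RingClass

variable {K : Type} [Field K] [NumberField K] (ι : K →+* ℂ) (hK : IsImaginaryQuadratic K)
  {m m' n : ℕ} (hm'n : m' ∣ n) (hn : n ≠ 0)

/-- Membership in `Gal(K[n]/K[m]) = ringClassGalOver ι n m` in terms of complex values: `σ` fixes
every `x ∈ K[n]` whose complex value lies in `K[m]`. [folklore] -/
theorem mem_ringClassGalOver_iff (σ : ringClassField K ι n ≃ₐ[ℚ] ringClassField K ι n) :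
    σ ∈ ringClassGalOver ι n m ↔
      ∀ x : ringClassField K ι n, (x : ℂ) ∈ ringClassField K ι m → σ x = x := by
  rw [ringClassGalOver, mem_fixingSubgroup_iff]
  rfl

/-- **`σ ∈ Gal(K[n]/K[m]) ⇒ res σ ∈ Gal(K[m']/K[m])`** (`m ∣ m' ∣ n`). [folklore] -/
theorem restrictGal_mem_ringClassGalOver (σ : ringClassGal ι n)
    (hσ : σ.1 ∈ ringClassGalOver ι n m) :
    (restrictGal ι hK hm'n hn σ).1 ∈ ringClassGalOver ι m' m := by
  rw [mem_ringClassGalOver_iff] at hσ ⊢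
  intro x hx
  apply Subtype.ext
  rw [coe_restrictGal_apply]
  have hfix := hσ (RingClassField.inclusion ι (ringClassField_mono hK ι hm'n hn) x)
    (by rw [RingClassField.coe_inclusion]; exact hx)
  rw [hfix, RingClassField.coe_inclusion]

/-- **`res σ₁ = res σ₂ ⟺ σ₁⁻¹ σ₂ ∈ Gal(K[n]/K[m'])`**: two automorphisms of `K[n]` have the same
restriction to `K[m']` iff they agree on (the image of) `K[m']`. [folklore] -/
theorem restrictGal_eq_iff (σ₁ σ₂ : ringClassGal ι n) :
    restrictGal ι hK hm'n hn σ₁ = restrictGal ι hK hm'n hn σ₂ ↔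
      σ₁.1⁻¹ * σ₂.1 ∈ ringClassGalOver ι n m' := by
  rw [mem_ringClassGalOver_iff]
  constructor
  · intro h x hx
    -- `x = incl x'` with `x' = ⟨x, hx⟩ ∈ K[m']`
    have hx' : x = RingClassField.inclusion ι (ringClassField_mono hK ι hm'n hn) ⟨(x : ℂ), hx⟩ :=
      Subtype.ext (by rw [RingClassField.coe_inclusion])
    rw [AlgEquiv.mul_apply, hx']
    apply σ₁.1.injective
    rw [← AlgEquiv.mul_apply, mul_inv_cancel, AlgEquiv.one_apply]
    apply Subtype.ext
    rw [← coe_restrictGal_apply ι hK hm'n hn σ₂, ← coe_restrictGal_apply ι hK hm'n hn σ₁, h]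
  · intro h
    apply Subtype.ext
    apply AlgEquiv.ext
    intro x'
    apply Subtype.ext
    rw [coe_restrictGal_apply, coe_restrictGal_apply]
    have hx := h (RingClassField.inclusion ι (ringClassField_mono hK ι hm'n hn) x')
      (by rw [RingClassField.coe_inclusion]; exact x'.2)
    rw [AlgEquiv.mul_apply] at hx
    have := congrArg σ₁.1 hx
    rw [← AlgEquiv.mul_apply, mul_inv_cancel, AlgEquiv.one_apply] at this
    rw [this]

/-- **Lifting**: every `τ ∈ Gal(K[m']/K[m])` (`m ∣ m' ∣ n`) is the restriction of some
`σ ∈ Gal(K[n]/K[m])` (Mathlib `AlgEquiv.liftNormal` along the normal extension `K[n]/K`, then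
`liftNormal_commutes`). [folklore] -/
theorem exists_restrictGal_eq (hmm' : m ∣ m') (τ : ringClassField K ι m' ≃ₐ[ℚ] ringClassField K ι m')
    (hτK : τ ∈ ringClassGal ι m') (hτ : τ ∈ ringClassGalOver ι m' m) :
    ∃ σ : ringClassGal ι n, σ.1 ∈ ringClassGalOver ι n m ∧ (restrictGal ι hK hm'n hn σ).1 = τ := by
  have hm' : m' ≠ 0 := ne_zero_of_dvd hm'n hn
  have hle : ringClassField K ι m' ≤ ringClassField K ι n := ringClassField_mono hK ι hm'n hn
  letI : Algebra (ringClassField K ι m') (ringClassField K ι n) :=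
    (RingClassField.inclusion ι hle).toRingHom.toAlgebra
  haveI : IsScalarTower K (ringClassField K ι m') (ringClassField K ι n) :=
    IsScalarTower.of_algebraMap_eq fun k => ((RingClassField.inclusion ι hle).commutes k).symm
  haveI := (finiteDimensional_and_isGalois_ringClassField hK ι hn).2
  haveI := (finiteDimensional_and_isGalois_ringClassField hK ι hm').2
  set τK : ringClassField K ι m' ≃ₐ[K] ringClassField K ι m' := algEquivOfMem ι m' ⟨τ, hτK⟩ with hτK_def
  set σK : ringClassField K ι n ≃ₐ[K] ringClassField K ι n := τK.liftNormal (ringClassField K ι n)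
    with hσK_def
  -- the key pointwise identity on complex values: `σK (incl x') = incl (τ x')`
  have hkey : ∀ x' : ringClassField K ι m',
      ((σK (RingClassField.inclusion ι hle x') : ringClassField K ι n) : ℂ) = ((τ x' : _) : ℂ) := by
    intro x'
    have h := AlgEquiv.liftNormal_commutes τK (ringClassField K ι n) x'
    -- `h : σK (algebraMap K[m'] K[n] x') = algebraMap K[m'] K[n] (τK x')`
    have h' := congrArg (fun z : ringClassField K ι n => (z : ℂ)) h
    rw [show (algebraMap (ringClassField K ι m') (ringClassField K ι n)) =
        (RingClassField.inclusion ι hle).toRingHom from rfl, AlgHom.toRingHom_eq_coe,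
      AlgHom.coe_toRingHom, RingClassField.coe_inclusion] at h'
    exact h'
  refine ⟨⟨σK.restrictScalars ℚ, restrictScalars_mem_ringClassGal ι n σK⟩, ?_, ?_⟩
  · -- `σ` fixes the elements of `K[n]` with complex value in `K[m]`
    rw [mem_ringClassGalOver_iff]
    intro x hx
    have hxm' : (x : ℂ) ∈ ringClassField K ι m' := ringClassField_mono hK ι hmm' hm' hx
    have hx' : x = RingClassField.inclusion ι hle ⟨(x : ℂ), hxm'⟩ :=
      Subtype.ext (by rw [RingClassField.coe_inclusion])
    apply Subtype.ext
    rw [hx']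
    change ((σK (RingClassField.inclusion ι hle ⟨(x : ℂ), hxm'⟩) : ringClassField K ι n) : ℂ) = _
    rw [hkey, RingClassField.coe_inclusion]
    have hfix := (mem_ringClassGalOver_iff ι τ).mp hτ ⟨(x : ℂ), hxm'⟩ hx
    rw [hfix]
  · -- `res σ = τ`
    apply AlgEquiv.ext
    intro x'
    apply Subtype.ext
    rw [coe_restrictGal_apply]
    exact hkey x'

/-- **TRANSPORT OF A RELATIVE TRACE `E(K[m']) → E(K[n])`** (`m ∣ m' ∣ n`). With
`G = Gal(K[n]/K)`, `H' = Gal(K[n]/K[m])`, `H = Gal(K[n]/K[m'])` (as subgroups of `G`) and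
`incl : E(K[m']) → E(K[n])`: for `y ∈ E(K[m'])`,
`Σ_{e ∈ H'/H} ẽ · incl(y) = incl( Σ_{τ ∈ Gal(K[m']/K[m])} τ · y )` — the restriction `e ↦ res ẽ` is a
bijection `H'/H ≃ Gal(K[m']/K[m])` (`restrictGal_eq_iff`, `exists_restrictGal_eq`) and
`ẽ · incl(y) = incl(res ẽ · y)` (`map_inclusion_pointGalHom_restrictGal`). The left side is exactly the
relative trace that `GenusCongruence.sum_quotient_eq_smul_of_rel` folds; the right side is the
`E(K[m'])`-valued form of the printed one-step relations (u2-lit's `sum_pointGalHom_eq_smul`).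
[folklore] -/
theorem sum_quotient_pointGalHom_map_inclusion (hmm' : m ∣ m') (W : WeierstrassCurve ℚ)
    [Fintype (((ringClassGalOver ι n m).subgroupOf (ringClassGal ι n)) ⧸
      (((ringClassGalOver ι n m').subgroupOf (ringClassGal ι n)).subgroupOf
        ((ringClassGalOver ι n m).subgroupOf (ringClassGal ι n))))]
    [Fintype (ringClassGalOver ι m' m)]
    (y : (W.baseChange (ringClassField K ι m' : Type)).toAffine.Point) :
    ∑ e : ((ringClassGalOver ι n m).subgroupOf (ringClassGal ι n)) ⧸
        (((ringClassGalOver ι n m').subgroupOf (ringClassGal ι n)).subgroupOf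
          ((ringClassGalOver ι n m).subgroupOf (ringClassGal ι n))),
      pointGalHom W (ringClassField K ι n)
        ((e.out : (ringClassGalOver ι n m).subgroupOf (ringClassGal ι n)) : ringClassGal ι n).1
        (WeierstrassCurve.Affine.Point.map (W' := W)
          (RingClassField.inclusion ι (ringClassField_mono hK ι hm'n hn)).toRingHom.toRatAlgHom y) =
    WeierstrassCurve.Affine.Point.map (W' := W)
      (RingClassField.inclusion ι (ringClassField_mono hK ι hm'n hn)).toRingHom.toRatAlgHom
      (∑ τ : ringClassGalOver ι m' m, pointGalHom W (ringClassField K ι m') τ.1 y) := by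
  -- abbreviations
  set G₀ := ringClassGal ι n
  set H' : Subgroup G₀ := (ringClassGalOver ι n m).subgroupOf G₀ with hH'
  set H : Subgroup G₀ := (ringClassGalOver ι n m').subgroupOf G₀ with hH
  -- the comparison map on representatives: `σ ↦ res σ`
  let Φ : H' → ringClassGalOver ι m' m := fun σ =>
    ⟨(restrictGal ι hK hm'n hn (σ : G₀)).1,
      restrictGal_mem_ringClassGalOver ι hK hm'n hn (σ : G₀) (Subgroup.mem_subgroupOf.mp σ.2)⟩
  have hΦres : ∀ σ₁ σ₂ : H', Φ σ₁ = Φ σ₂ ↔ σ₁⁻¹ * σ₂ ∈ H.subgroupOf H' := by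
    intro σ₁ σ₂
    rw [Subgroup.mem_subgroupOf, hH, Subgroup.mem_subgroupOf, Subtype.ext_iff]
    change (restrictGal ι hK hm'n hn (σ₁ : G₀)).1 = (restrictGal ι hK hm'n hn (σ₂ : G₀)).1 ↔ _
    rw [← Subtype.ext_iff, restrictGal_eq_iff]
    rfl
  have hinj : Function.Injective fun c : H' ⧸ H.subgroupOf H' => Φ c.out := by
    intro c₁ c₂ h
    have hmem : c₁.out⁻¹ * c₂.out ∈ H.subgroupOf H' := (hΦres _ _).mp h
    rw [← QuotientGroup.out_eq' c₁, ← QuotientGroup.out_eq' c₂]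
    exact QuotientGroup.eq.mpr hmem
  have hsurj : Function.Surjective fun c : H' ⧸ H.subgroupOf H' => Φ c.out := by
    intro τ
    obtain ⟨σ, hσm, hres⟩ := exists_restrictGal_eq ι hK hm'n hn hmm' τ.1
      (ringClassGalOver_le_ringClassGal ι m' m τ.2) τ.2
    let σ' : H' := ⟨σ, Subgroup.mem_subgroupOf.mpr hσm⟩
    refine ⟨(σ' : H' ⧸ H.subgroupOf H'), ?_⟩
    obtain ⟨h, hh⟩ := QuotientGroup.mk_out_eq_mul (H.subgroupOf H') σ'
    have hΦ : Φ ((σ' : H' ⧸ H.subgroupOf H').out) = Φ σ' := by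
      rw [hΦres, hh, mul_inv_rev, mul_assoc, inv_mul_cancel, mul_one]
      exact inv_mem h.2
    change Φ ((σ' : H' ⧸ H.subgroupOf H').out) = τ
    rw [hΦ]
    exact Subtype.ext hres
  rw [map_sum]
  -- `convert`: the binder `Fintype` instance and the one `set` produced differ syntactically
  convert Fintype.sum_bijective (fun c : H' ⧸ H.subgroupOf H' => Φ c.out) ⟨hinj, hsurj⟩
    (fun c => pointGalHom W (ringClassField K ι n) ((c.out : H') : G₀).1
      (WeierstrassCurve.Affine.Point.map (W' := W)
        (RingClassField.inclusion ι (ringClassField_mono hK ι hm'n hn)).toRingHom.toRatAlgHom y))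
    (fun τ => WeierstrassCurve.Affine.Point.map (W' := W)
      (RingClassField.inclusion ι (ringClassField_mono hK ι hm'n hn)).toRingHom.toRatAlgHom
      (pointGalHom W (ringClassField K ι m') τ.1 y))
    fun c => (map_inclusion_pointGalHom_restrictGal ι hK hm'n hn W ((c.out : H') : G₀) y).symm

/-- **Inclusions compose on points**: for `m ∣ m' ∣ n` and `P ∈ E(K[m])`,
`incl_{m'→n}(incl_{m→m'} P) = incl_{m→n} P` (all three are the identity on complex coordinates).
[folklore] -/
theorem map_inclusion_map_inclusion (hmm' : m ∣ m') (W : WeierstrassCurve ℚ)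
    (P : (W.baseChange (ringClassField K ι m : Type)).toAffine.Point) :
    WeierstrassCurve.Affine.Point.map (W' := W)
        (RingClassField.inclusion ι (ringClassField_mono hK ι hm'n hn)).toRingHom.toRatAlgHom
        (WeierstrassCurve.Affine.Point.map (W' := W)
          (RingClassField.inclusion ι
            (ringClassField_mono hK ι hmm' (ne_zero_of_dvd hm'n hn))).toRingHom.toRatAlgHom P) =
      WeierstrassCurve.Affine.Point.map (W' := W)
        (RingClassField.inclusion ι
          (ringClassField_mono hK ι (hmm'.trans hm'n) hn)).toRingHom.toRatAlgHom P := by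
  rw [WeierstrassCurve.Affine.Point.map_map]
  have hcomp :
      (RingClassField.inclusion ι (ringClassField_mono hK ι hm'n hn)).toRingHom.toRatAlgHom.comp
        (RingClassField.inclusion ι
          (ringClassField_mono hK ι hmm' (ne_zero_of_dvd hm'n hn))).toRingHom.toRatAlgHom =
      (RingClassField.inclusion ι
        (ringClassField_mono hK ι (hmm'.trans hm'n) hn)).toRingHom.toRatAlgHom := by
    apply AlgHom.ext
    intro x
    apply Subtype.ext
    change ((RingClassField.inclusion ι (ringClassField_mono hK ι hm'n hn)
        (RingClassField.inclusion ι (ringClassField_mono hK ι hmm' (ne_zero_of_dvd hm'n hn)) x) :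
          ringClassField K ι n) : ℂ) =
      ((RingClassField.inclusion ι (ringClassField_mono hK ι (hmm'.trans hm'n) hn) x :
        ringClassField K ι n) : ℂ)
    rw [RingClassField.coe_inclusion, RingClassField.coe_inclusion, RingClassField.coe_inclusion]
  rw [hcomp]

/-- **THE INDUCTIVE STEP OF THE TOWER, inside `Gal(K[n]/K)`** (`m ∣ m' ∣ n`): a one-step trace
relation printed at top field `K[m']`,
`Σ_{τ ∈ Gal(K[m']/K[m])} τ · y_{m'} = a · incl_{m→m'}(y_m)` in `E(K[m'])`
(e.g. `a = a_q` for `m' = mq`, `q` inert — `CoatesLiTianZhai2015.traceRelation_inert` via u2-lit's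
`sum_pointGalHom_eq_smul`), becomes after pushing to `E(K[n])` the RELATIVE-trace relation
`Σ_{e ∈ Gal(K[n]/K[m]) / Gal(K[n]/K[m'])} ẽ · incl_{m'→n}(y_{m'}) = a · incl_{m→n}(y_m)` — the
hypothesis `hrel` of `GenusCongruence.sum_quotient_eq_smul_of_rel` /
`sum_eq_mul_smul_of_two_steps`. [folklore] -/
theorem sum_quotient_pointGalHom_eq_smul_of_step (hmm' : m ∣ m') (W : WeierstrassCurve ℚ)
    [Fintype (((ringClassGalOver ι n m).subgroupOf (ringClassGal ι n)) ⧸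
      (((ringClassGalOver ι n m').subgroupOf (ringClassGal ι n)).subgroupOf
        ((ringClassGalOver ι n m).subgroupOf (ringClassGal ι n))))]
    [Fintype (ringClassGalOver ι m' m)]
    (y : (W.baseChange (ringClassField K ι m' : Type)).toAffine.Point)
    (yM : (W.baseChange (ringClassField K ι m : Type)).toAffine.Point) (a : ℤ)
    (hstep : ∑ τ : ringClassGalOver ι m' m, pointGalHom W (ringClassField K ι m') τ.1 y =
      a • WeierstrassCurve.Affine.Point.map (W' := W)
        (RingClassField.inclusion ι
          (ringClassField_mono hK ι hmm' (ne_zero_of_dvd hm'n hn))).toRingHom.toRatAlgHom yM) :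
    ∑ e : ((ringClassGalOver ι n m).subgroupOf (ringClassGal ι n)) ⧸
        (((ringClassGalOver ι n m').subgroupOf (ringClassGal ι n)).subgroupOf
          ((ringClassGalOver ι n m).subgroupOf (ringClassGal ι n))),
      pointGalHom W (ringClassField K ι n)
        ((e.out : (ringClassGalOver ι n m).subgroupOf (ringClassGal ι n)) : ringClassGal ι n).1
        (WeierstrassCurve.Affine.Point.map (W' := W)
          (RingClassField.inclusion ι (ringClassField_mono hK ι hm'n hn)).toRingHom.toRatAlgHom y) =
    a • WeierstrassCurve.Affine.Point.map (W' := W)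
      (RingClassField.inclusion ι
        (ringClassField_mono hK ι (hmm'.trans hm'n) hn)).toRingHom.toRatAlgHom yM := by
  rw [sum_quotient_pointGalHom_map_inclusion ι hK hm'n hn hmm' W y, hstep, map_zsmul,
    map_inclusion_map_inclusion ι hK hm'n hn hmm' W yM]

/-- The same inductive step with the one-step relation in the `finsum` currency of the landed
consumers (`CoatesLiTianZhai2015.traceRelation_inert.sum_pointGalHom_eq_smul`:
`∑ᶠ σ ∈ Gal(K[m']/K[m]), σ·y = a • y_M`). [folklore] -/
theorem sum_quotient_pointGalHom_eq_smul_of_finsum_step (hmm' : m ∣ m') (W : WeierstrassCurve ℚ)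
    [Fintype (((ringClassGalOver ι n m).subgroupOf (ringClassGal ι n)) ⧸
      (((ringClassGalOver ι n m').subgroupOf (ringClassGal ι n)).subgroupOf
        ((ringClassGalOver ι n m).subgroupOf (ringClassGal ι n))))]
    [Fintype (ringClassGalOver ι m' m)]
    (y : (W.baseChange (ringClassField K ι m' : Type)).toAffine.Point)
    (yM : (W.baseChange (ringClassField K ι m : Type)).toAffine.Point) (a : ℤ)
    (hstep : ∑ᶠ τ ∈ (ringClassGalOver ι m' m :
        Set (ringClassField K ι m' ≃ₐ[ℚ] ringClassField K ι m')),
        pointGalHom W (ringClassField K ι m') τ y =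
      a • WeierstrassCurve.Affine.Point.map (W' := W)
        (RingClassField.inclusion ι
          (ringClassField_mono hK ι hmm' (ne_zero_of_dvd hm'n hn))).toRingHom.toRatAlgHom yM) :
    ∑ e : ((ringClassGalOver ι n m).subgroupOf (ringClassGal ι n)) ⧸
        (((ringClassGalOver ι n m').subgroupOf (ringClassGal ι n)).subgroupOf
          ((ringClassGalOver ι n m).subgroupOf (ringClassGal ι n))),
      pointGalHom W (ringClassField K ι n)
        ((e.out : (ringClassGalOver ι n m).subgroupOf (ringClassGal ι n)) : ringClassGal ι n).1
        (WeierstrassCurve.Affine.Point.map (W' := W)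
          (RingClassField.inclusion ι (ringClassField_mono hK ι hm'n hn)).toRingHom.toRatAlgHom y) =
    a • WeierstrassCurve.Affine.Point.map (W' := W)
      (RingClassField.inclusion ι
        (ringClassField_mono hK ι (hmm'.trans hm'n) hn)).toRingHom.toRatAlgHom yM := by
  apply sum_quotient_pointGalHom_eq_smul_of_step ι hK hm'n hn hmm' W y yM a
  rw [← hstep, ← finsum_set_coe_eq_finsum_mem, finsum_eq_sum_of_fintype]
  exact Fintype.sum_equiv (Equiv.refl _) _ _ (fun _ => rfl)

/-! ### Small tower API used by the composite-conductor assembly -/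

include hK hm'n hn in
/-- `Gal(K[n]/K[m']) ≤ Gal(K[n]/K[m])` for `m ∣ m'` (`K[m] ⊆ K[m']`). [folklore] -/
theorem ringClassGalOver_anti (hmm' : m ∣ m') :
    ringClassGalOver ι n m' ≤ ringClassGalOver ι n m := by
  intro σ hσ
  rw [mem_ringClassGalOver_iff] at hσ ⊢
  exact fun x hx => hσ x (ringClassField_mono hK ι hmm' (ne_zero_of_dvd hm'n hn) hx)

/-- `Gal(K[n]/K[m'])` fixes the points pushed forward from `E(K[m'])`. [folklore] -/
theorem pointGalHom_map_inclusion_eq_of_mem (W : WeierstrassCurve ℚ)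
    {σ : ringClassField K ι n ≃ₐ[ℚ] ringClassField K ι n} (hσ : σ ∈ ringClassGalOver ι n m')
    (P : (W.baseChange (ringClassField K ι m' : Type)).toAffine.Point) :
    pointGalHom W (ringClassField K ι n) σ
        (WeierstrassCurve.Affine.Point.map (W' := W)
          (RingClassField.inclusion ι (ringClassField_mono hK ι hm'n hn)).toRingHom.toRatAlgHom P) =
      WeierstrassCurve.Affine.Point.map (W' := W)
        (RingClassField.inclusion ι (ringClassField_mono hK ι hm'n hn)).toRingHom.toRatAlgHom P := by
  rw [pointGalHom_apply, WeierstrassCurve.Affine.Point.map_map]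
  have hcomp : (σ : ringClassField K ι n →ₐ[ℚ] ringClassField K ι n).comp
      (RingClassField.inclusion ι (ringClassField_mono hK ι hm'n hn)).toRingHom.toRatAlgHom =
      (RingClassField.inclusion ι (ringClassField_mono hK ι hm'n hn)).toRingHom.toRatAlgHom := by
    apply AlgHom.ext
    intro x
    rw [AlgHom.comp_apply]
    apply (mem_ringClassGalOver_iff ι σ).mp hσ
    change ((RingClassField.inclusion ι (ringClassField_mono hK ι hm'n hn) x :
      ringClassField K ι n) : ℂ) ∈ ringClassField K ι m'
    rw [RingClassField.coe_inclusion]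
    exact x.2
  rw [hcomp]

/-- Complex coordinates are unchanged by the push-forward `E(K[m']) → E(K[n])`. [folklore] -/
theorem map_subtype_map_inclusion (W : WeierstrassCurve ℚ)
    (P : (W.baseChange (ringClassField K ι m' : Type)).toAffine.Point) :
    WeierstrassCurve.Affine.Point.map (ringClassField K ι n).subtype.toRatAlgHom
        (WeierstrassCurve.Affine.Point.map (W' := W)
          (RingClassField.inclusion ι (ringClassField_mono hK ι hm'n hn)).toRingHom.toRatAlgHom P) =
      WeierstrassCurve.Affine.Point.map (ringClassField K ι m').subtype.toRatAlgHom P := by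
  rw [WeierstrassCurve.Affine.Point.map_map]
  have hcomp : (ringClassField K ι n).subtype.toRatAlgHom.comp
      (RingClassField.inclusion ι (ringClassField_mono hK ι hm'n hn)).toRingHom.toRatAlgHom =
      (ringClassField K ι m').subtype.toRatAlgHom := by
    apply AlgHom.ext
    intro x
    rw [AlgHom.comp_apply]
    change ((RingClassField.inclusion ι (ringClassField_mono hK ι hm'n hn) x :
      ringClassField K ι n) : ℂ) = (x : ℂ)
    rw [RingClassField.coe_inclusion]
  rw [hcomp]

end Summit.BirchSwinnertonDyer.Uniform.U2.RingClass

end
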